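import Summits.QuantumAdvantage.QuantumAdvantage.Theorems.LinnikCubicClassGroupsDegreeOnePrimesEscapeOfDensities
import Literature.NumberTheory.LFunctions.ClassGroupLogFreeTheorem14AllDegrees
import Literature.NumberTheory.LFunctions.DedekindZeta1LogFreeTheorem14AllDegrees
import HarnessLib

/-!
# The crux `DegreeOnePrimesEscape` — PROVED, every degree, unconditionally

Topic `Summits/QuantumAdvantage/QuantumAdvantage/Theorems`; closes the crux `DegreeOnePrimesEscape`
(stmt-QuantumAdvantage-11543) of route `LinnikCubicClassGroups` (the identical declaration is rank 5 of route
`ThirdFactorialPincer`); cell B2b-1 (linnik-cubic), PART A (successor seat) on top of PART B's composition.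
HONEST FRAMING (block-2b rule): the value of this file is a THEOREM — a kernel-checked, GRH-free, Siegel-free
Linnik–Stark escape count in every degree — NOT summit progress: on route `LinnikCubicClassGroups` the summit
still needs the hypothesis-type target `PureCubicClassNumberHard` (and on `ThirdFactorialPincer` its own targets).

`degreeOnePrimesEscape_of_logFreeDensities` (PART B, `…DegreeOnePrimesEscapeOfDensities.lean`) derives the crux
BY NAME from the two log-free zero-density estimates in every degree `n ≥ 3`: X1(n) for the non-trivial
class-group twists and X2(n) for `ζ₁_K = (s−1)ζ_K` with the pole term (through the degree-local one-sided
per-character deficit T4, the lower prime ideal theorem dichotomy T5, Stark's residue bound R and zero-free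
interval S, and the per-field composition of line `subgroup-orthogonality-escape`).  The tree had X1 for
`n ≤ 4` and X2 for `n ≤ 3` only; `logFreeDensity_classGroup_all` and `logFreeDensity_dedekindZeta₁_all`
(PART A: Bombieri's Théorème 14 in every degree — large-slack abstract Lemme B `lemmeB_core_abstract_of_le`,
wide Gallagher kernel `A = (n+2)T'`, degree-dependent size constants and sieve parameter `z = N_X^{1/(2n+4)}`;
trivial range by PART B) supply them in EVERY degree, so the crux closes:

* `degreeOnePrimesEscape_proof` — `Theses.LinnikCubicClassGroups.DegreeOnePrimesEscape`: for every `n` there is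
  `C = C(n)` such that for every number field `K` of degree `n` with NO quadratic subfield, every `x ≥ |d_K|^C` and
  every proper subgroup `M` of `Cl(𝓞_K)`: `π(x) ≤ 8 · #{P prime of 𝓞_K : N(P) prime, N(P) ≤ x, [P] ∉ M}`;
  (the identical declaration of route `ThirdFactorialPincer` follows in `…DegreeOnePrimesEscapeProofTFP.lean`);
* `stub_logFreeDensityCG`, `stub_logFreeDensityZ1`, `stub_lowerPIT_of_density` — the remaining registered stubs X1,
  X2, T5 of line `subgroup-orthogonality-escape`, discharged with their registered signatures.

Axioms: `propext`, `Classical.choice`, `Quot.sound`.  No GRH; no hypothesis on Landau–Siegel zeros (a field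
without quadratic subfield has no exceptional zero of `ζ_K` by Stark 1974, and exceptional zeros of the
non-trivial twists only depress the character sums — the one-sidedness of T4).  Sources of the method:
Bombieri 1987 (*Le grand crible*, §6 Thm. 14), Weiss 1983 Thm. 4.3, Thorner–Zaman 2017 §4–5 and 2019 Thm. 3.2
(without the Deuring–Heilbronn factor), Stark 1974 Lemma 4 / Thm. 3.
-/

noncomputable section

open scoped NumberField nonZeroDivisors
open Literature.NumberTheory.LFunctions Literature.NumberTheory.LFunctions.NumberField

namespace Summit.QuantumAdvantage.QuantumAdvantage.Theorems.DegreeOnePrimesEscape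

/-- **THE CRUX `DegreeOnePrimesEscape` (route `LinnikCubicClassGroups`, stmt-QuantumAdvantage-11543),
UNCONDITIONAL** — the Linnik–Stark escape count in every degree: for every `n` there is `C = C(n)` such that
for every number field `K` of degree `n` with NO quadratic subfield, every `x ≥ |d_K|^C` and every proper
subgroup `M` of `Cl(𝓞_K)`: `π(x) ≤ 8 · #{P prime of 𝓞_K : N(P) prime, N(P) ≤ x, [P] ∉ M}`.
(PART B's `degreeOnePrimesEscape_of_logFreeDensities` fed with PART A's all-degree log-free zero-density estimates
`logFreeDensity_classGroup_all`, `logFreeDensity_dedekindZeta₁_all`.)  Value = a theorem, NOT summit progress. -/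
theorem degreeOnePrimesEscape_proof :
    Summit.QuantumAdvantage.QuantumAdvantage.Theses.LinnikCubicClassGroups.DegreeOnePrimesEscape :=
  degreeOnePrimesEscape_of_logFreeDensities (fun n _ => logFreeDensity_classGroup_all n)
    (fun n _ => logFreeDensity_dedekindZeta₁_all n)


/-! ### The registered density stubs of line `subgroup-orthogonality-escape`, discharged -/

open scoped Classical in
/-- **STUB X1 · `stub_logFreeDensityCG` of line `subgroup-orthogonality-escape`, PROVED** (registered signature
verbatim): the log-free zero-density estimate for the non-trivial class-group `L`-functions in every degree. -/
theorem stub_logFreeDensityCG : ∀ n : ℕ, ∃ c_D C_D : ℝ, 0 < c_D ∧ 0 < C_D ∧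
    ∀ (K : Type) [Field K] [NumberField K], Module.finrank ℚ K = n →
      (∀ χ : ClassGroup (𝓞 K) →* ℂˣ, χ ≠ 1 → ∀ ρ : ℂ,
        Literature.NumberTheory.LFunctions.NumberField.classGroupLFunction₀ K χ ρ = 0 → ρ.re < 1) →
      ∀ P : ℝ, 2 ≤ P → ((NumberField.discr K).natAbs : ℝ) ≤ P → (Fintype.card (ClassGroup (𝓞 K)) : ℝ) ≤ P →
        P⁻¹ ≤ NumberField.dedekindZeta_residue K →
      ∀ Z : (ClassGroup (𝓞 K) →* ℂˣ) → Finset ℂ,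
        (∀ χ : ClassGroup (𝓞 K) →* ℂˣ, χ ≠ 1 → ∀ ρ ∈ Z χ,
          Literature.NumberTheory.LFunctions.NumberField.classGroupLFunction₀ K χ ρ = 0 ∧ 1 / 4 ≤ ρ.re ∧ ρ.re < 1 ∧
            |ρ.im| ≤ P) →
        ∀ α : ℝ, 0 ≤ α → α ≤ 1 →
          ∑ ψ : AddChar (Additive (ClassGroup (𝓞 K))) ℂ with ψ ≠ 0,
            ∑ ρ ∈ Z (Literature.NumberTheory.LFunctions.AbelianDensity.toMulHom ψ).toHomUnits with α ≤ ρ.re,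
              (Literature.NumberTheory.LFunctions.LogFreeLocal.zeroOrder
                (Literature.NumberTheory.LFunctions.NumberField.classGroupLFunction₀ K
                  (Literature.NumberTheory.LFunctions.AbelianDensity.toMulHom ψ).toHomUnits) ρ : ℝ) ≤
                C_D * P ^ (c_D * (1 - α)) :=
  fun n => logFreeDensity_classGroup_all n

open scoped Classical in
/-- **STUB X2 · `stub_logFreeDensityZ1` of line `subgroup-orthogonality-escape`, PROVED** (registered signature
verbatim): the log-free zero-density estimate for `ζ₁_K` (pole term included) in every degree. -/
theorem stub_logFreeDensityZ1 : ∀ n : ℕ, ∃ c_D C_D : ℝ, 0 < c_D ∧ 0 < C_D ∧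
    ∀ (K : Type) [Field K] [NumberField K], Module.finrank ℚ K = n →
      ∀ P : ℝ, 2 ≤ P → ((NumberField.discr K).natAbs : ℝ) ≤ P → (Fintype.card (ClassGroup (𝓞 K)) : ℝ) ≤ P →
        P⁻¹ ≤ NumberField.dedekindZeta_residue K →
      ∀ Z : Finset ℂ, (∀ ρ ∈ Z, Literature.NumberTheory.LFunctions.dedekindZeta₁ K ρ = 0 ∧ 1 / 4 ≤ ρ.re ∧ ρ.re < 1 ∧
          |ρ.im| ≤ P) →
        ∀ α : ℝ, 0 ≤ α → α ≤ 1 →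
          ∑ ρ ∈ Z with α ≤ ρ.re,
            (Literature.NumberTheory.LFunctions.LogFreeLocal.zeroOrder (Literature.NumberTheory.LFunctions.dedekindZeta₁ K) ρ : ℝ) ≤
              C_D * P ^ (c_D * (1 - α)) :=
  fun n => logFreeDensity_dedekindZeta₁_all n

open scoped Classical in
/-- **STUB T5 · `stub_lowerPIT_of_density` of line `subgroup-orthogonality-escape`, PROVED** (registered signature
verbatim; the all-degree density hypothesis is read at the one degree `n` by `lowerPIT_of_density_local`). -/
theorem stub_lowerPIT_of_density :
    (∀ n : ℕ, ∃ c_D C_D : ℝ, 0 < c_D ∧ 0 < C_D ∧ ∀ (K : Type) [Field K] [NumberField K], Module.finrank ℚ K = n →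
      ∀ P : ℝ, 2 ≤ P → ((NumberField.discr K).natAbs : ℝ) ≤ P → (Fintype.card (ClassGroup (𝓞 K)) : ℝ) ≤ P →
        P⁻¹ ≤ NumberField.dedekindZeta_residue K →
      ∀ Z : Finset ℂ, (∀ ρ ∈ Z, Literature.NumberTheory.LFunctions.dedekindZeta₁ K ρ = 0 ∧ 1 / 4 ≤ ρ.re ∧ ρ.re < 1 ∧
          |ρ.im| ≤ P) →
        ∀ α : ℝ, 0 ≤ α → α ≤ 1 →
          ∑ ρ ∈ Z with α ≤ ρ.re,
            (Literature.NumberTheory.LFunctions.LogFreeLocal.zeroOrder (Literature.NumberTheory.LFunctions.dedekindZeta₁ K) ρ : ℝ) ≤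
              C_D * P ^ (c_D * (1 - α))) →
    ∀ n : ℕ, 1 < n → ∀ A : ℝ, 0 ≤ A → ∃ C₁ : ℝ, ∀ (K : Type) [Field K] [NumberField K], Module.finrank ℚ K = n →
      Literature.NumberTheory.LFunctions.NumberField.ThornerZaman.condQn K ^ (-A) ≤ NumberField.dedekindZeta_residue K →
      ∀ x : ℝ, Literature.NumberTheory.LFunctions.NumberField.ThornerZaman.condQn K ^ C₁ ≤ x →
        29 * Literature.NumberTheory.LFunctions.offsetLogIntegral x ≤
            32 * (Literature.NumberTheory.LFunctions.NumberField.primeIdealCount K x : ℝ) ∨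
          ∃ β₁ : ℝ, 1 - 1 / (8 * Real.log (Literature.NumberTheory.LFunctions.NumberField.ThornerZaman.condQn K)) < β₁ ∧ β₁ < 1 ∧
            Literature.NumberTheory.LFunctions.dedekindZetaCont K β₁ = 0 ∧ (1 - β₁) * Real.log x < 4 :=
  fun hX2 n hn A _ => lowerPIT_of_density_local n hn A (hX2 n)

end Summit.QuantumAdvantage.QuantumAdvantage.Theorems.DegreeOnePrimesEscape

end
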